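import Summits.BirchSwinnertonDyer.BirchSwinnertonDyer.Theorems.Rank2Observatory2DescKillSig2XCore
import HarnessLib

/-!
# KERNEL-2DESC — the 2-ADIC signature certificate for ONE `ℤ₂`-root + a QUADRATIC place (`KillSig2X`), PART 2 of 5:
# the core lemma and the shape lemma at a RAMIFIED quadratic place
# (rank-2 observatory, cert-1 gen 39/40; design `b2b-bsdr2-cert-1/…/generics/sig2x/README-SIG2X.md`, census `census/sig2x/`)

HONEST FRAMING: per-curve certified theorems and census instruments; no claim on BSD in rank ≥ 2.
PARTITION: none — rank ≥ 2 data (N3); no r ≤ 1 cell claimed.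

Ramified case of PART 1 (`Rank2Observatory2DescKillSig2XCore`): `K_w = ℚ₂(w)`, `w² = s₁w + s₀` with `s₁ = 2d`,
`s₀ = 2c`, `c` odd (an Eisenstein equation; `w` a uniformiser, `w² = 2η`, `η = c + d·w` a unit).  A pair `x` with
`x₀` odd is a unit; `x₀` even and `x₁` odd means `w`-valuation `1`.  Two facts drive the certificate's quadratic leaf:

* `coreE` — `2^N ∣ 2^s·Z·R² − 2^j·W` (coordinate-wise, `Z₀`, `W₀` odd, `j + 2 < N`) forces `η^{(s+j) mod 2}·Z·W` to be
  a square mod `8·O_w` (`isSq8`): unlike the unramified case the parity of the power of `2` is NOT an invariant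
  (`R = w·ρ` has `R² = 2ηρ²`) — it twists the unit class by `η`; the witness in that case is `Z·(Rw/2)`;
* `shapeE` — the same relation with `W₀` even and `W₁` odd (odd `w`-valuation) is impossible.

Both are inductions on `j` peeling one factor `2` (or `4 = ` the square of `2 ∣ R`) at a time, exactly as `core8` /
`coreU`.  Integer pair arithmetic only; no instances, no `native_decide`, sorry-free.
[cite: Cassels1991LecturesEllipticCurves, §15] [cite: CremonaAlgorithms1997, §3.6]
-/

-- single-conjunct summit: `Summit.BirchSwinnertonDyer.BirchSwinnertonDyer.…` repeats the name by design
set_option linter.dupNamespace false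

namespace Summit.BirchSwinnertonDyer.BirchSwinnertonDyer.Rank2Observatory.TwoDescKill

/-! ### The core lemma at a RAMIFIED quadratic place (`s₁ = 2d`, `s₀ = 2c`, `c` odd; `w` a uniformiser, `w² = 2η`, `η = c + d·w`) -/

/-- The `η`-twist by a parity bit: `x` for even `b`, `η·x` for odd `b` (`η = (c, d) = w²/2`). [folklore] -/
def etw (c d : ℤ) (b : ℕ) (x : ℤ × ℤ) : ℤ × ℤ := if b % 2 = 0 then x else qmul (2 * d) (2 * c) (c, d) x

/-- At a ramified place, `Z·R²` with `Z₀` odd and both coordinates even forces `R₀` even. [folklore] -/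
theorem eis_even_fst {c d : ℤ} {Z R : ℤ × ℤ} (hZ : ¬ (2 : ℤ) ∣ Z.1)
    (h : (2 : ℤ) ∣ (qmul (2 * d) (2 * c) Z (qmul (2 * d) (2 * c) R R)).1) : (2 : ℤ) ∣ R.1 := by
  simp only [qmul, ← even_iff_two_dvd, Int.even_add, Int.even_mul, even_two, true_or, or_true,
    iff_true] at *
  tauto

/-- **Core lemma at a ramified quadratic place.** `2^N ∣ 2^s·Z·R² − 2^j·W` coordinate-wise with `Z₀`, `W₀`
odd (`Z`, `W` units of `O_w`) and `j + 2 < N` forces `η^{(s+j) mod 2}·Z·W` to be a square mod `8`: the parity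
of the power of `2` is absorbed by `R = w·ρ` (`R² = 2ηρ²`), so it twists the class by `η = w²/2` instead of being
an invariant. Induction on `j` as `core8`. [folklore] -/
theorem coreE {c d : ℤ} (hc : ¬ (2 : ℤ) ∣ c) {Z W : ℤ × ℤ} (hZ : ¬ (2 : ℤ) ∣ Z.1) (hW : ¬ (2 : ℤ) ∣ W.1)
    (j : ℕ) : ∀ (s N : ℕ) (R : ℤ × ℤ), j + 2 < N →
      (2 : ℤ) ^ N ∣ (2 : ℤ) ^ s * (qmul (2 * d) (2 * c) Z (qmul (2 * d) (2 * c) R R)).1 - (2 : ℤ) ^ j * W.1 →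
      (2 : ℤ) ^ N ∣ (2 : ℤ) ^ s * (qmul (2 * d) (2 * c) Z (qmul (2 * d) (2 * c) R R)).2 - (2 : ℤ) ^ j * W.2 →
      isSq8 (2 * d) (2 * c) (etw c d (s + j) (qmul (2 * d) (2 * c) Z W)) = true := by
  induction' j using Nat.strong_induction_on with j ih
  rintro s N ⟨R₁, R₂⟩ hjN h₁ h₂
  have hq0 : (2 : ℤ) ≠ 0 := by norm_num
  have hqN : (2 : ℤ) ∣ (2 : ℤ) ^ N := dvd_pow_self _ (by omega)
  cases j with
  | zero =>
    cases s with
    | zero =>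
      simp only [etw, Nat.add_zero, Nat.zero_mod, if_true]
      obtain ⟨N', rfl⟩ : ∃ N', N = N' + 3 := ⟨N - 3, by omega⟩
      have h8 : (8 : ℤ) ∣ (2 : ℤ) ^ (N' + 3) := ⟨(2 : ℤ) ^ N', by ring⟩
      have g₁ : (8 : ℤ) ∣ (qmul (2 * d) (2 * c) Z (qmul (2 * d) (2 * c) (R₁, R₂) (R₁, R₂))).1 - W.1 := by
        simpa using h8.trans h₁
      have g₂ : (8 : ℤ) ∣ (qmul (2 * d) (2 * c) Z (qmul (2 * d) (2 * c) (R₁, R₂) (R₁, R₂))).2 - W.2 := by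
        simpa using h8.trans h₂
      refine isSq8_of_witness (qmul (2 * d) (2 * c) Z (R₁, R₂)) ?_ ?_
      · have e : (qmul (2 * d) (2 * c) (qmul (2 * d) (2 * c) Z (R₁, R₂)) (qmul (2 * d) (2 * c) Z (R₁, R₂))).1 -
            (qmul (2 * d) (2 * c) Z W).1 =
            Z.1 * ((qmul (2 * d) (2 * c) Z (qmul (2 * d) (2 * c) (R₁, R₂) (R₁, R₂))).1 - W.1) +
              Z.2 * ((qmul (2 * d) (2 * c) Z (qmul (2 * d) (2 * c) (R₁, R₂) (R₁, R₂))).2 - W.2) * (2 * c) := by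
          simp only [qmul]; ring
        rw [e]
        exact dvd_add (dvd_mul_of_dvd_right g₁ _) (dvd_mul_of_dvd_left (dvd_mul_of_dvd_right g₂ _) _)
      · have e : (qmul (2 * d) (2 * c) (qmul (2 * d) (2 * c) Z (R₁, R₂)) (qmul (2 * d) (2 * c) Z (R₁, R₂))).2 -
            (qmul (2 * d) (2 * c) Z W).2 =
            Z.1 * ((qmul (2 * d) (2 * c) Z (qmul (2 * d) (2 * c) (R₁, R₂) (R₁, R₂))).2 - W.2) +
              Z.2 * ((qmul (2 * d) (2 * c) Z (qmul (2 * d) (2 * c) (R₁, R₂) (R₁, R₂))).1 - W.1) +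
              Z.2 * ((qmul (2 * d) (2 * c) Z (qmul (2 * d) (2 * c) (R₁, R₂) (R₁, R₂))).2 - W.2) * (2 * d) := by
          simp only [qmul]; ring
        rw [e]
        exact dvd_add (dvd_add (dvd_mul_of_dvd_right g₂ _) (dvd_mul_of_dvd_right g₁ _))
          (dvd_mul_of_dvd_left (dvd_mul_of_dvd_right g₂ _) _)
    | succ s =>
      exfalso
      apply hW
      have h2 : (2 : ℤ) ∣ (2 : ℤ) ^ (s + 1) * (qmul (2 * d) (2 * c) Z (qmul (2 * d) (2 * c) (R₁, R₂) (R₁, R₂))).1 :=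
        dvd_mul_of_dvd_left (dvd_pow_self _ (Nat.succ_ne_zero s)) _
      have := dvd_sub h2 (hqN.trans h₁); simpa using this
  | succ j =>
    cases s with
    | succ s =>
      obtain ⟨N', rfl⟩ : ∃ N', N = N' + 1 := ⟨N - 1, by omega⟩
      have d₁ : (2 : ℤ) ^ N' ∣ (2 : ℤ) ^ s * (qmul (2 * d) (2 * c) Z (qmul (2 * d) (2 * c) (R₁, R₂) (R₁, R₂))).1 -
          (2 : ℤ) ^ j * W.1 := by
        refine pow_dvd_cancel (k := 1) ?_
        have e : (2 : ℤ) ^ 1 * ((2 : ℤ) ^ s * (qmul (2 * d) (2 * c) Z (qmul (2 * d) (2 * c) (R₁, R₂) (R₁, R₂))).1 -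
            (2 : ℤ) ^ j * W.1) = (2 : ℤ) ^ (s + 1) * (qmul (2 * d) (2 * c) Z (qmul (2 * d) (2 * c) (R₁, R₂) (R₁, R₂))).1 -
            (2 : ℤ) ^ (j + 1) * W.1 := by ring
        rw [e]; exact h₁
      have d₂ : (2 : ℤ) ^ N' ∣ (2 : ℤ) ^ s * (qmul (2 * d) (2 * c) Z (qmul (2 * d) (2 * c) (R₁, R₂) (R₁, R₂))).2 -
          (2 : ℤ) ^ j * W.2 := by
        refine pow_dvd_cancel (k := 1) ?_
        have e : (2 : ℤ) ^ 1 * ((2 : ℤ) ^ s * (qmul (2 * d) (2 * c) Z (qmul (2 * d) (2 * c) (R₁, R₂) (R₁, R₂))).2 -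
            (2 : ℤ) ^ j * W.2) = (2 : ℤ) ^ (s + 1) * (qmul (2 * d) (2 * c) Z (qmul (2 * d) (2 * c) (R₁, R₂) (R₁, R₂))).2 -
            (2 : ℤ) ^ (j + 1) * W.2 := by ring
        rw [e]; exact h₂
      have := ih j (by omega) s N' (R₁, R₂) (by omega) d₁ d₂
      have ep : s + 1 + (j + 1) = (s + j) + 2 := by ring
      rw [ep]
      simpa [etw, Nat.add_mod_right] using this
    | zero =>
      -- both coordinates of `Z·R²` are even, so `R₁` is even
      have hj2 : ∀ X : ℤ, (2 : ℤ) ∣ (2 : ℤ) ^ (j + 1) * X := fun X =>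
        dvd_mul_of_dvd_left (dvd_pow_self _ (Nat.succ_ne_zero j)) X
      have hX₁ : (2 : ℤ) ∣ (qmul (2 * d) (2 * c) Z (qmul (2 * d) (2 * c) (R₁, R₂) (R₁, R₂))).1 := by
        have := dvd_add (hqN.trans h₁) (hj2 W.1); simpa using this
      obtain ⟨e, rfl⟩ : (2 : ℤ) ∣ R₁ := eis_even_fst hZ hX₁
      by_cases ho : (2 : ℤ) ∣ R₂
      · -- `R = 2ρ`: peel `4`
        obtain ⟨o, rfl⟩ := ho
        have e₁ : (qmul (2 * d) (2 * c) Z (qmul (2 * d) (2 * c) (2 * e, 2 * o) (2 * e, 2 * o))).1 =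
            4 * (qmul (2 * d) (2 * c) Z (qmul (2 * d) (2 * c) (e, o) (e, o))).1 := by simp only [qmul]; ring
        have e₂ : (qmul (2 * d) (2 * c) Z (qmul (2 * d) (2 * c) (2 * e, 2 * o) (2 * e, 2 * o))).2 =
            4 * (qmul (2 * d) (2 * c) Z (qmul (2 * d) (2 * c) (e, o) (e, o))).2 := by simp only [qmul]; ring
        rw [e₁] at h₁
        rw [e₂] at h₂
        cases j with
        | zero =>
          exfalso
          apply hW
          obtain ⟨N', rfl⟩ : ∃ N', N = N' + 2 := ⟨N - 2, by omega⟩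
          have h4 : (2 : ℤ) * 2 ∣ (2 : ℤ) ^ (N' + 2) := ⟨(2 : ℤ) ^ N', by ring⟩
          have hA := h4.trans h₁
          have hB : (2 : ℤ) * 2 ∣ (2 : ℤ) * W.1 := by
            have e' : (2 : ℤ) * W.1 = (2 : ℤ) * 2 * (qmul (2 * d) (2 * c) Z (qmul (2 * d) (2 * c) (e, o) (e, o))).1 -
                ((2 : ℤ) ^ 0 * (4 * (qmul (2 * d) (2 * c) Z (qmul (2 * d) (2 * c) (e, o) (e, o))).1) -
                  (2 : ℤ) ^ (0 + 1) * W.1) := by ring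
            rw [e']; exact dvd_sub (dvd_mul_right _ _) hA
          exact (mul_dvd_mul_iff_left hq0).mp hB
        | succ j =>
          obtain ⟨N', rfl⟩ : ∃ N', N = N' + 2 := ⟨N - 2, by omega⟩
          have d₁ : (2 : ℤ) ^ N' ∣ (2 : ℤ) ^ 0 * (qmul (2 * d) (2 * c) Z (qmul (2 * d) (2 * c) (e, o) (e, o))).1 -
              (2 : ℤ) ^ j * W.1 := by
            refine pow_dvd_cancel (k := 2) ?_
            have e' : (2 : ℤ) ^ 2 * ((2 : ℤ) ^ 0 * (qmul (2 * d) (2 * c) Z (qmul (2 * d) (2 * c) (e, o) (e, o))).1 -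
                (2 : ℤ) ^ j * W.1) = (2 : ℤ) ^ 0 * (4 * (qmul (2 * d) (2 * c) Z (qmul (2 * d) (2 * c) (e, o) (e, o))).1) -
                (2 : ℤ) ^ (j + 1 + 1) * W.1 := by ring
            rw [e']; exact h₁
          have d₂ : (2 : ℤ) ^ N' ∣ (2 : ℤ) ^ 0 * (qmul (2 * d) (2 * c) Z (qmul (2 * d) (2 * c) (e, o) (e, o))).2 -
              (2 : ℤ) ^ j * W.2 := by
            refine pow_dvd_cancel (k := 2) ?_
            have e' : (2 : ℤ) ^ 2 * ((2 : ℤ) ^ 0 * (qmul (2 * d) (2 * c) Z (qmul (2 * d) (2 * c) (e, o) (e, o))).2 -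
                (2 : ℤ) ^ j * W.2) = (2 : ℤ) ^ 0 * (4 * (qmul (2 * d) (2 * c) Z (qmul (2 * d) (2 * c) (e, o) (e, o))).2) -
                (2 : ℤ) ^ (j + 1 + 1) * W.2 := by ring
            rw [e']; exact h₂
          have := ih j (by omega) 0 N' (e, o) (by omega) d₁ d₂
          have ep : 0 + (j + 1 + 1) = (0 + j) + 2 := by ring
          rw [ep]
          simpa [etw, Nat.add_mod_right] using this
      · -- `R = w·ρ`-shaped: `R² = 2σ`, `σ = (2e² + o²c, 2eo + o²d)` a unit, `σ·η = (oc + (e + od)w)²`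
        set σ : ℤ × ℤ := (2 * e ^ 2 + R₂ ^ 2 * c, 2 * e * R₂ + R₂ ^ 2 * d) with hσ
        have eσ₁ : (qmul (2 * d) (2 * c) Z (qmul (2 * d) (2 * c) (2 * e, R₂) (2 * e, R₂))).1 =
            2 * (qmul (2 * d) (2 * c) Z σ).1 := by simp only [qmul, hσ]; ring
        have eσ₂ : (qmul (2 * d) (2 * c) Z (qmul (2 * d) (2 * c) (2 * e, R₂) (2 * e, R₂))).2 =
            2 * (qmul (2 * d) (2 * c) Z σ).2 := by simp only [qmul, hσ]; ring
        rw [eσ₁] at h₁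
        rw [eσ₂] at h₂
        have hσodd : ¬ (2 : ℤ) ∣ (qmul (2 * d) (2 * c) Z σ).1 := by
          simp only [qmul, hσ, ← even_iff_two_dvd, Int.even_add, Int.even_mul, Int.even_pow, even_two,
            true_or, or_true, iff_true, true_iff] at hZ hc ho ⊢
          tauto
        cases j with
        | zero =>
          -- `Z·σ ≡ W (mod 2^(N-1))`: witness `t = Z·(oc, e + od)` for `η·Z·W`
          simp only [etw, Nat.zero_add, Nat.one_mod, if_false, one_ne_zero]
          obtain ⟨N', rfl⟩ : ∃ N', N = N' + 4 := ⟨N - 4, by omega⟩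
          have h16 : (2 : ℤ) * 8 ∣ (2 : ℤ) ^ (N' + 4) := ⟨(2 : ℤ) ^ N', by ring⟩
          have g₁ : (8 : ℤ) ∣ (qmul (2 * d) (2 * c) Z σ).1 - W.1 := by
            have hA := h16.trans h₁
            have e' : (2 : ℤ) ^ 0 * (2 * (qmul (2 * d) (2 * c) Z σ).1) - (2 : ℤ) ^ (0 + 1) * W.1 =
                2 * ((qmul (2 * d) (2 * c) Z σ).1 - W.1) := by ring
            rw [e'] at hA
            exact (mul_dvd_mul_iff_left hq0).mp hA
          have g₂ : (8 : ℤ) ∣ (qmul (2 * d) (2 * c) Z σ).2 - W.2 := by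
            have hA := h16.trans h₂
            have e' : (2 : ℤ) ^ 0 * (2 * (qmul (2 * d) (2 * c) Z σ).2) - (2 : ℤ) ^ (0 + 1) * W.2 =
                2 * ((qmul (2 * d) (2 * c) Z σ).2 - W.2) := by ring
            rw [e'] at hA
            exact (mul_dvd_mul_iff_left hq0).mp hA
          refine isSq8_of_witness (qmul (2 * d) (2 * c) Z (R₂ * c, e + R₂ * d)) ?_ ?_
          · have key : (qmul (2 * d) (2 * c) (qmul (2 * d) (2 * c) Z (R₂ * c, e + R₂ * d))
                (qmul (2 * d) (2 * c) Z (R₂ * c, e + R₂ * d))).1 =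
                (qmul (2 * d) (2 * c) (c, d) (qmul (2 * d) (2 * c) Z (qmul (2 * d) (2 * c) Z σ))).1 := by
              simp only [qmul, hσ]; ring
            obtain ⟨q₁, -⟩ := dvd_qmul (s₁ := 2 * d) (s₀ := 2 * c) (c, d)
              (G := qmul (2 * d) (2 * c) Z ((qmul (2 * d) (2 * c) Z σ).1 - W.1, (qmul (2 * d) (2 * c) Z σ).2 - W.2))
              (dvd_qmul (s₁ := 2 * d) (s₀ := 2 * c) Z (G := ((qmul (2 * d) (2 * c) Z σ).1 - W.1,
                (qmul (2 * d) (2 * c) Z σ).2 - W.2)) g₁ g₂).1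
              (dvd_qmul (s₁ := 2 * d) (s₀ := 2 * c) Z (G := ((qmul (2 * d) (2 * c) Z σ).1 - W.1,
                (qmul (2 * d) (2 * c) Z σ).2 - W.2)) g₁ g₂).2
            have lin : (qmul (2 * d) (2 * c) (c, d) (qmul (2 * d) (2 * c) Z W)).1 =
                (qmul (2 * d) (2 * c) (c, d) (qmul (2 * d) (2 * c) Z (qmul (2 * d) (2 * c) Z σ))).1 -
                (qmul (2 * d) (2 * c) (c, d) (qmul (2 * d) (2 * c) Z
                    ((qmul (2 * d) (2 * c) Z σ).1 - W.1, (qmul (2 * d) (2 * c) Z σ).2 - W.2))).1 := by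
              simp only [qmul]; ring
            rw [lin, key]
            have : ∀ X Y : ℤ, (8 : ℤ) ∣ Y → (8 : ℤ) ∣ X - (X - Y) := fun X Y h => by simpa using h
            exact this _ _ q₁
          · have key : (qmul (2 * d) (2 * c) (qmul (2 * d) (2 * c) Z (R₂ * c, e + R₂ * d))
                (qmul (2 * d) (2 * c) Z (R₂ * c, e + R₂ * d))).2 =
                (qmul (2 * d) (2 * c) (c, d) (qmul (2 * d) (2 * c) Z (qmul (2 * d) (2 * c) Z σ))).2 := by
              simp only [qmul, hσ]; ring
            obtain ⟨-, q₂⟩ := dvd_qmul (s₁ := 2 * d) (s₀ := 2 * c) (c, d)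
              (G := qmul (2 * d) (2 * c) Z ((qmul (2 * d) (2 * c) Z σ).1 - W.1, (qmul (2 * d) (2 * c) Z σ).2 - W.2))
              (dvd_qmul (s₁ := 2 * d) (s₀ := 2 * c) Z (G := ((qmul (2 * d) (2 * c) Z σ).1 - W.1,
                (qmul (2 * d) (2 * c) Z σ).2 - W.2)) g₁ g₂).1
              (dvd_qmul (s₁ := 2 * d) (s₀ := 2 * c) Z (G := ((qmul (2 * d) (2 * c) Z σ).1 - W.1,
                (qmul (2 * d) (2 * c) Z σ).2 - W.2)) g₁ g₂).2
            have lin : (qmul (2 * d) (2 * c) (c, d) (qmul (2 * d) (2 * c) Z W)).2 =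
                (qmul (2 * d) (2 * c) (c, d) (qmul (2 * d) (2 * c) Z (qmul (2 * d) (2 * c) Z σ))).2 -
                (qmul (2 * d) (2 * c) (c, d) (qmul (2 * d) (2 * c) Z
                    ((qmul (2 * d) (2 * c) Z σ).1 - W.1, (qmul (2 * d) (2 * c) Z σ).2 - W.2))).2 := by
              simp only [qmul]; ring
            rw [lin, key]
            have : ∀ X Y : ℤ, (8 : ℤ) ∣ Y → (8 : ℤ) ∣ X - (X - Y) := fun X Y h => by simpa using h
            exact this _ _ q₂
        | succ j =>
          -- `Z·σ ≡ 2^j·W ≡ 0 (mod 2)` contradicts `(Z·σ)₀` odd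
          exfalso
          apply hσodd
          obtain ⟨N', rfl⟩ : ∃ N', N = N' + 2 := ⟨N - 2, by omega⟩
          have h4 : (2 : ℤ) * 2 ∣ (2 : ℤ) ^ (N' + 2) := ⟨(2 : ℤ) ^ N', by ring⟩
          have hA := h4.trans h₁
          have hB : (2 : ℤ) * 2 ∣ 2 * (qmul (2 * d) (2 * c) Z σ).1 := by
            have e' : (2 : ℤ) * (qmul (2 * d) (2 * c) Z σ).1 =
                ((2 : ℤ) ^ 0 * (2 * (qmul (2 * d) (2 * c) Z σ).1) - (2 : ℤ) ^ (j + 1 + 1) * W.1) +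
                  (2 : ℤ) * 2 * ((2 : ℤ) ^ j * W.1) := by ring
            rw [e']; exact dvd_add hA (dvd_mul_right _ _)
          exact (mul_dvd_mul_iff_left hq0).mp hB

/-- **Shape mismatch at a ramified place.** `2^N ∣ 2^s·Z·R² − 2^j·W` with `Z₀` odd but `W₀` even and `W₁` odd
(`W` of odd `w`-valuation, `Z·R²` of even `w`-valuation) is impossible for `j + 2 < N`. [folklore] -/
theorem shapeE {c d : ℤ} (hc : ¬ (2 : ℤ) ∣ c) {Z W : ℤ × ℤ} (hZ : ¬ (2 : ℤ) ∣ Z.1) (hW₁ : (2 : ℤ) ∣ W.1)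
    (hW₂ : ¬ (2 : ℤ) ∣ W.2) (j : ℕ) : ∀ (s N : ℕ) (R : ℤ × ℤ), j + 2 < N →
      (2 : ℤ) ^ N ∣ (2 : ℤ) ^ s * (qmul (2 * d) (2 * c) Z (qmul (2 * d) (2 * c) R R)).1 - (2 : ℤ) ^ j * W.1 →
      (2 : ℤ) ^ N ∣ (2 : ℤ) ^ s * (qmul (2 * d) (2 * c) Z (qmul (2 * d) (2 * c) R R)).2 - (2 : ℤ) ^ j * W.2 →
      False := by
  induction' j using Nat.strong_induction_on with j ih
  rintro s N ⟨R₁, R₂⟩ hjN h₁ h₂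
  have hq0 : (2 : ℤ) ≠ 0 := by norm_num
  have hqN : (2 : ℤ) ∣ (2 : ℤ) ^ N := dvd_pow_self _ (by omega)
  -- a product `Z·X` with both coordinates of `X` even has both coordinates even
  have evZ : ∀ X : ℤ × ℤ, (2 : ℤ) ∣ X.1 → (2 : ℤ) ∣ X.2 → (2 : ℤ) ∣ (qmul (2 * d) (2 * c) Z X).2 := by
    intro X hX₁ hX₂
    simp only [qmul]
    exact dvd_add (dvd_add (dvd_mul_of_dvd_right hX₂ _) (dvd_mul_of_dvd_right hX₁ _))
      (dvd_mul_of_dvd_left (dvd_mul_of_dvd_right hX₂ _) _)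
  cases j with
  | zero =>
    cases s with
    | zero =>
      -- `Z·R² ≡ W (mod 4)`: `W₀` even forces `R₁` even, then `(Z·R²)₁` even, so `W₁` even
      obtain ⟨N', rfl⟩ : ∃ N', N = N' + 2 := ⟨N - 2, by omega⟩
      have h4 : (2 : ℤ) ∣ (2 : ℤ) ^ (N' + 2) := ⟨2 * (2 : ℤ) ^ N', by ring⟩
      have g₁ : (2 : ℤ) ∣ (qmul (2 * d) (2 * c) Z (qmul (2 * d) (2 * c) (R₁, R₂) (R₁, R₂))).1 - W.1 := by
        simpa using h4.trans h₁
      have g₂ : (2 : ℤ) ∣ (qmul (2 * d) (2 * c) Z (qmul (2 * d) (2 * c) (R₁, R₂) (R₁, R₂))).2 - W.2 := by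
        simpa using h4.trans h₂
      have hX₁ : (2 : ℤ) ∣ (qmul (2 * d) (2 * c) Z (qmul (2 * d) (2 * c) (R₁, R₂) (R₁, R₂))).1 := by
        have := dvd_add g₁ hW₁; simpa using this
      obtain ⟨e, rfl⟩ : (2 : ℤ) ∣ R₁ := eis_even_fst hZ hX₁
      have hsq₁ : (2 : ℤ) ∣ (qmul (2 * d) (2 * c) (2 * e, R₂) (2 * e, R₂)).1 :=
        ⟨2 * e * e + R₂ * R₂ * c, by simp only [qmul]; ring⟩
      have hsq₂ : (2 : ℤ) ∣ (qmul (2 * d) (2 * c) (2 * e, R₂) (2 * e, R₂)).2 :=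
        ⟨e * R₂ + R₂ * e + R₂ * R₂ * d, by simp only [qmul]; ring⟩
      apply hW₂
      have := dvd_sub (evZ _ hsq₁ hsq₂) g₂; simpa using this
    | succ s =>
      apply hW₂
      have h2 : (2 : ℤ) ∣ (2 : ℤ) ^ (s + 1) * (qmul (2 * d) (2 * c) Z (qmul (2 * d) (2 * c) (R₁, R₂) (R₁, R₂))).2 :=
        dvd_mul_of_dvd_left (dvd_pow_self _ (Nat.succ_ne_zero s)) _
      have := dvd_sub h2 (hqN.trans h₂); simpa using this
  | succ j =>
    cases s with
    | succ s =>
      obtain ⟨N', rfl⟩ : ∃ N', N = N' + 1 := ⟨N - 1, by omega⟩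
      refine ih j (by omega) s N' (R₁, R₂) (by omega) ?_ ?_
      · refine pow_dvd_cancel (k := 1) ?_
        have e : (2 : ℤ) ^ 1 * ((2 : ℤ) ^ s * (qmul (2 * d) (2 * c) Z (qmul (2 * d) (2 * c) (R₁, R₂) (R₁, R₂))).1 -
            (2 : ℤ) ^ j * W.1) = (2 : ℤ) ^ (s + 1) * (qmul (2 * d) (2 * c) Z (qmul (2 * d) (2 * c) (R₁, R₂) (R₁, R₂))).1 -
            (2 : ℤ) ^ (j + 1) * W.1 := by ring
        rw [e]; exact h₁
      · refine pow_dvd_cancel (k := 1) ?_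
        have e : (2 : ℤ) ^ 1 * ((2 : ℤ) ^ s * (qmul (2 * d) (2 * c) Z (qmul (2 * d) (2 * c) (R₁, R₂) (R₁, R₂))).2 -
            (2 : ℤ) ^ j * W.2) = (2 : ℤ) ^ (s + 1) * (qmul (2 * d) (2 * c) Z (qmul (2 * d) (2 * c) (R₁, R₂) (R₁, R₂))).2 -
            (2 : ℤ) ^ (j + 1) * W.2 := by ring
        rw [e]; exact h₂
    | zero =>
      have hj2 : ∀ X : ℤ, (2 : ℤ) ∣ (2 : ℤ) ^ (j + 1) * X := fun X =>
        dvd_mul_of_dvd_left (dvd_pow_self _ (Nat.succ_ne_zero j)) X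
      have hX₁ : (2 : ℤ) ∣ (qmul (2 * d) (2 * c) Z (qmul (2 * d) (2 * c) (R₁, R₂) (R₁, R₂))).1 := by
        have := dvd_add (hqN.trans h₁) (hj2 W.1); simpa using this
      obtain ⟨e, rfl⟩ : (2 : ℤ) ∣ R₁ := eis_even_fst hZ hX₁
      by_cases ho : (2 : ℤ) ∣ R₂
      · obtain ⟨o, rfl⟩ := ho
        have e₁ : (qmul (2 * d) (2 * c) Z (qmul (2 * d) (2 * c) (2 * e, 2 * o) (2 * e, 2 * o))).1 =
            4 * (qmul (2 * d) (2 * c) Z (qmul (2 * d) (2 * c) (e, o) (e, o))).1 := by simp only [qmul]; ring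
        have e₂ : (qmul (2 * d) (2 * c) Z (qmul (2 * d) (2 * c) (2 * e, 2 * o) (2 * e, 2 * o))).2 =
            4 * (qmul (2 * d) (2 * c) Z (qmul (2 * d) (2 * c) (e, o) (e, o))).2 := by simp only [qmul]; ring
        rw [e₁] at h₁
        rw [e₂] at h₂
        cases j with
        | zero =>
          apply hW₂
          obtain ⟨N', rfl⟩ : ∃ N', N = N' + 2 := ⟨N - 2, by omega⟩
          have h4 : (2 : ℤ) * 2 ∣ (2 : ℤ) ^ (N' + 2) := ⟨(2 : ℤ) ^ N', by ring⟩
          have hA := h4.trans h₂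
          have hB : (2 : ℤ) * 2 ∣ (2 : ℤ) * W.2 := by
            have e' : (2 : ℤ) * W.2 = (2 : ℤ) * 2 * (qmul (2 * d) (2 * c) Z (qmul (2 * d) (2 * c) (e, o) (e, o))).2 -
                ((2 : ℤ) ^ 0 * (4 * (qmul (2 * d) (2 * c) Z (qmul (2 * d) (2 * c) (e, o) (e, o))).2) -
                  (2 : ℤ) ^ (0 + 1) * W.2) := by ring
            rw [e']; exact dvd_sub (dvd_mul_right _ _) hA
          exact (mul_dvd_mul_iff_left hq0).mp hB
        | succ j =>
          obtain ⟨N', rfl⟩ : ∃ N', N = N' + 2 := ⟨N - 2, by omega⟩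
          refine ih j (by omega) 0 N' (e, o) (by omega) ?_ ?_
          · refine pow_dvd_cancel (k := 2) ?_
            have e' : (2 : ℤ) ^ 2 * ((2 : ℤ) ^ 0 * (qmul (2 * d) (2 * c) Z (qmul (2 * d) (2 * c) (e, o) (e, o))).1 -
                (2 : ℤ) ^ j * W.1) = (2 : ℤ) ^ 0 * (4 * (qmul (2 * d) (2 * c) Z (qmul (2 * d) (2 * c) (e, o) (e, o))).1) -
                (2 : ℤ) ^ (j + 1 + 1) * W.1 := by ring
            rw [e']; exact h₁
          · refine pow_dvd_cancel (k := 2) ?_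
            have e' : (2 : ℤ) ^ 2 * ((2 : ℤ) ^ 0 * (qmul (2 * d) (2 * c) Z (qmul (2 * d) (2 * c) (e, o) (e, o))).2 -
                (2 : ℤ) ^ j * W.2) = (2 : ℤ) ^ 0 * (4 * (qmul (2 * d) (2 * c) Z (qmul (2 * d) (2 * c) (e, o) (e, o))).2) -
                (2 : ℤ) ^ (j + 1 + 1) * W.2 := by ring
            rw [e']; exact h₂
      · set σ : ℤ × ℤ := (2 * e ^ 2 + R₂ ^ 2 * c, 2 * e * R₂ + R₂ ^ 2 * d) with hσ
        have eσ₁ : (qmul (2 * d) (2 * c) Z (qmul (2 * d) (2 * c) (2 * e, R₂) (2 * e, R₂))).1 =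
            2 * (qmul (2 * d) (2 * c) Z σ).1 := by simp only [qmul, hσ]; ring
        have eσ₂ : (qmul (2 * d) (2 * c) Z (qmul (2 * d) (2 * c) (2 * e, R₂) (2 * e, R₂))).2 =
            2 * (qmul (2 * d) (2 * c) Z σ).2 := by simp only [qmul, hσ]; ring
        rw [eσ₁] at h₁
        rw [eσ₂] at h₂
        have hσodd : ¬ (2 : ℤ) ∣ (qmul (2 * d) (2 * c) Z σ).1 := by
          simp only [qmul, hσ, ← even_iff_two_dvd, Int.even_add, Int.even_mul, Int.even_pow, even_two,
            true_or, or_true, iff_true, true_iff] at hZ hc ho ⊢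
          tauto
        apply hσodd
        cases j with
        | zero =>
          -- `Z·σ ≡ W (mod 2)`, `W₀` even
          obtain ⟨N', rfl⟩ : ∃ N', N = N' + 2 := ⟨N - 2, by omega⟩
          have h4 : (2 : ℤ) * 2 ∣ (2 : ℤ) ^ (N' + 2) := ⟨(2 : ℤ) ^ N', by ring⟩
          have hA := h4.trans h₁
          obtain ⟨k, hk⟩ := hW₁
          have hB : (2 : ℤ) * 2 ∣ 2 * (qmul (2 * d) (2 * c) Z σ).1 := by
            have e' : (2 : ℤ) * (qmul (2 * d) (2 * c) Z σ).1 =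
                ((2 : ℤ) ^ 0 * (2 * (qmul (2 * d) (2 * c) Z σ).1) - (2 : ℤ) ^ (0 + 1) * W.1) + 2 * 2 * k := by
              rw [hk]; ring
            rw [e']; exact dvd_add hA (dvd_mul_right _ _)
          exact (mul_dvd_mul_iff_left hq0).mp hB
        | succ j =>
          obtain ⟨N', rfl⟩ : ∃ N', N = N' + 2 := ⟨N - 2, by omega⟩
          have h4 : (2 : ℤ) * 2 ∣ (2 : ℤ) ^ (N' + 2) := ⟨(2 : ℤ) ^ N', by ring⟩
          have hA := h4.trans h₁
          have hB : (2 : ℤ) * 2 ∣ 2 * (qmul (2 * d) (2 * c) Z σ).1 := by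
            have e' : (2 : ℤ) * (qmul (2 * d) (2 * c) Z σ).1 =
                ((2 : ℤ) ^ 0 * (2 * (qmul (2 * d) (2 * c) Z σ).1) - (2 : ℤ) ^ (j + 1 + 1) * W.1) +
                  (2 : ℤ) * 2 * ((2 : ℤ) ^ j * W.1) := by ring
            rw [e']; exact dvd_add hA (dvd_mul_right _ _)
          exact (mul_dvd_mul_iff_left hq0).mp hB

end Summit.BirchSwinnertonDyer.BirchSwinnertonDyer.Rank2Observatory.TwoDescKill
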